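import Summits.QuantumFields.YangMills.Theorems.BalabanUVNodesN19FejerMean
import Mathlib.Analysis.SpecialFunctions.Trigonometric.Sinc
import Mathlib.Analysis.Calculus.MeanValue

/-!
# YM-DAG node N19 (= NE7 proper) — FEJÉR–STEKLOV SMOOTHING OF A PERIODIC LIPSCHITZ FUNCTION
# (a trigonometric link within `Λ(δ + π(1 + log L)∕L)` whose derivative is EXPLICITLY a difference quotient: `|g′| ≤ Λ`, `g′` `(Λ∕δ)`-Lipschitz)

Cell `pub-ymgap`, HUMAN RULING D-0062 (Track A) ∕ D-0149 (work-bound push), R141 (C) wider-strategy seat `pub-ymgap-dag-n19-e` (strategy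
s3 = ALTERNATIVE CURRENCY), generation g33, module 3 (lineage module 150b).  Route `Summits/QuantumFields/YangMills/Theses/BalabanUVNodes.lean`,
cluster item K3⁸ «SpineGivenEndpointR13SepCoPHV» (stmt-QuantumFields-27366); filed `--supports` that item `--as helper` (it proves no registered
stub).  COUNT-NEUTRAL: [folklore] one-dimensional analysis over Mathlib (`Real.sinc`, `HasDerivAt`, `Convex.norm_image_sub_le_of_norm_hasDerivWithin_le`,
`integral_cos` ∕ `integral_sin`; `sin x = x·sinc x` inlined — it is `Literature.Analysis.Fourier.sin_eq_mul_sinc`, not imported to keep the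
import closure small) and, BY NAME, module 150 `…N19FejerMean` (`fejerMean_eq_trigSum`, `abs_fejerMean_sub_le`, `abs_fejerMean_sub_fejerMean_le`,
`abs_fourierCoeff_le`); no laws, no scheme object, no Theses import; NOT a discharge claim.

ROLE IN THE LINEAGE.  PART 2 of the smoothing step of the SMOOTHED-LINK FIRST-ORDER LAW (module 151 `…N19SmoothLinkFirstOrder`).  Module 151 prices a
trigonometric link `g` by its `C^{1,1}` data (`|g(u) − g(a) − g′(a)(u − a)| ≤ B₂(u − a)²`, `|g′| ≤ B₁`); the Fejér mean `T` of module 150 is a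
trigonometric polynomial, `Λ`-Lipschitz, within `Λπ(1 + log L)∕L` of `f`, but its derivative is not priced by `Λ`.  THE STEKLOV STEP: the box average
`g(θ) = (1∕2δ)∫_{θ−δ}^{θ+δ} T` is again a trigonometric polynomial (coefficients damped by `sinc(ω_pδ)`), and `g′(θ) = (T(θ + δ) − T(θ − δ))∕2δ`
EXPLICITLY — so `|g′| ≤ Λ`, `|g′(a) − g′(b)| ≤ (Λ∕δ)|a − b|`, `|g(u) − g(a) − g′(a)(u − a)| ≤ (Λ∕δ)(u − a)²` and `|g − T| ≤ Λδ`, all priced by the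
Lipschitz constant alone: NO Bernstein inequality, NO kernel derivative, NO coefficient (ℓ¹) bound.
§1 sinc bookkeeping (`integral_cos_mul_window`, `integral_sin_mul_window`, the two difference identities); §2 the Steklov transform of an arbitrary
finite trigonometric sum (`steklov_eq_integral`, `hasDerivAt_steklov`, `steklovDeriv_eq_diffQuot`) and its four prices from a Lipschitz `T`
(`steklov_prices`: `|g₁| ≤ Λ`, `g₁` `(Λ∕δ)`-Lipschitz, the `C^{1,1}` bound, `|g − T| ≤ Λδ`); §3 ★★ `exists_trigLink_near_periodicLipschitz`:
for `f` continuous, `2π`-periodic, `Λ`-Lipschitz with `|f| ≤ M`, `L ≥ 1`, `δ > 0`: a trigonometric link `g = Σ_p(α_p cos ω_p· + β_p sin ω_p·)` over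
`p ∈ range L × range L`, `ω_p = |p₁ − p₂| ≤ L`, `Σ_p(|α_p| + |β_p|) ≤ 2LM`, derivative `g₁ = Σ_p ω_p(β_p cos − α_p sin)` with
`|g(u) − g(a) − g₁(a)(u − a)| ≤ (Λ∕δ)(u − a)²`, `|g₁| ≤ Λ`, `|g − f| ≤ Λ(δ + π(1 + log L)∕L)` — EXACTLY the input of module 151.

HONEST FRAMING (binding).  Elementary and [folklore] (Steklov means; Korneichuk 1991 §2 has the constants in one dimension); NO consumer in the DAG
today (a step of an optimality map of the seat's own currency, degree model); nothing of Bałaban's instantiated; NE7 NOT PRINTED, NOT proved; N19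
NOT discharged; count-neutral.  One finite `T⁴` programme at fixed `ε`; nothing continuum ∕ `ℝ⁴` ∕ OS ∕ mass-gap ∕ Clay.  0 `def` ∕ 0 `sorry`.
-/

noncomputable section

open Finset MeasureTheory intervalIntegral
open scoped Real

namespace Summit.QuantumFields.YangMills.Theorems.BalabanUVNodesN19FejerSteklovSmoothing

open Literature.Probability.LatticeModels (fejerKernel)
open Summit.QuantumFields.YangMills.Theorems.BalabanUVNodesN19FejerMean
  (fejerMean_eq_trigSum abs_fejerMean_sub_le abs_fejerMean_sub_fejerMean_le abs_fourierCoeff_le continuous_fejerKernel)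

/-! ## §1 sinc bookkeeping [bookkeeping] -/

/-- `∫_{θ−δ}^{θ+δ} cos(ωu) du = 2δ·sinc(ωδ)·cos(ωθ)`. [bookkeeping] -/
theorem integral_cos_mul_window (ω θ δ : ℝ) :
    ∫ u in (θ - δ)..(θ + δ), Real.cos (ω * u) = 2 * δ * Real.sinc (ω * δ) * Real.cos (ω * θ) := by
  by_cases hω : ω = 0
  · subst hω; simp; ring
  · rw [intervalIntegral.integral_comp_mul_left (fun s => Real.cos s) hω, integral_cos, smul_eq_mul,
      show ω * (θ + δ) = ω * θ + ω * δ by ring, show ω * (θ - δ) = ω * θ - ω * δ by ring, Real.sin_add, Real.sin_sub,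
      (by by_cases h0 : ω * δ = 0
          · simp [h0]
          · rw [Real.sinc_of_ne_zero h0, ← mul_div_assoc, mul_div_cancel_left₀ _ h0] : Real.sin (ω * δ) = ω * δ * Real.sinc (ω * δ))]
    field_simp
    ring

/-- `∫_{θ−δ}^{θ+δ} sin(ωu) du = 2δ·sinc(ωδ)·sin(ωθ)`. [bookkeeping] -/
theorem integral_sin_mul_window (ω θ δ : ℝ) :
    ∫ u in (θ - δ)..(θ + δ), Real.sin (ω * u) = 2 * δ * Real.sinc (ω * δ) * Real.sin (ω * θ) := by
  by_cases hω : ω = 0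
  · subst hω; simp
  · rw [intervalIntegral.integral_comp_mul_left (fun s => Real.sin s) hω, integral_sin, smul_eq_mul,
      show ω * (θ + δ) = ω * θ + ω * δ by ring, show ω * (θ - δ) = ω * θ - ω * δ by ring, Real.cos_add, Real.cos_sub,
      (by by_cases h0 : ω * δ = 0
          · simp [h0]
          · rw [Real.sinc_of_ne_zero h0, ← mul_div_assoc, mul_div_cancel_left₀ _ h0] : Real.sin (ω * δ) = ω * δ * Real.sinc (ω * δ))]
    field_simp
    ring

/-- `cos(ω(θ+δ)) − cos(ω(θ−δ)) = −2δ·ω·sinc(ωδ)·sin(ωθ)`. [bookkeeping] -/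
theorem cos_window_diff (ω θ δ : ℝ) :
    Real.cos (ω * (θ + δ)) - Real.cos (ω * (θ - δ)) = -(2 * δ * (ω * Real.sinc (ω * δ)) * Real.sin (ω * θ)) := by
  rw [show ω * (θ + δ) = ω * θ + ω * δ by ring, show ω * (θ - δ) = ω * θ - ω * δ by ring, Real.cos_add, Real.cos_sub]
  have h : Real.sin (ω * δ) = ω * δ * Real.sinc (ω * δ) := by
    by_cases h0 : ω * δ = 0
    · simp [h0]
    · rw [Real.sinc_of_ne_zero h0, ← mul_div_assoc, mul_div_cancel_left₀ _ h0]
  calc Real.cos (ω * θ) * Real.cos (ω * δ) - Real.sin (ω * θ) * Real.sin (ω * δ) -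
        (Real.cos (ω * θ) * Real.cos (ω * δ) + Real.sin (ω * θ) * Real.sin (ω * δ))
      = -(2 * Real.sin (ω * δ) * Real.sin (ω * θ)) := by ring
    _ = -(2 * δ * (ω * Real.sinc (ω * δ)) * Real.sin (ω * θ)) := by rw [h]; ring

/-- `sin(ω(θ+δ)) − sin(ω(θ−δ)) = 2δ·ω·sinc(ωδ)·cos(ωθ)`. [bookkeeping] -/
theorem sin_window_diff (ω θ δ : ℝ) :
    Real.sin (ω * (θ + δ)) - Real.sin (ω * (θ - δ)) = 2 * δ * (ω * Real.sinc (ω * δ)) * Real.cos (ω * θ) := by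
  rw [show ω * (θ + δ) = ω * θ + ω * δ by ring, show ω * (θ - δ) = ω * θ - ω * δ by ring, Real.sin_add, Real.sin_sub]
  have h : Real.sin (ω * δ) = ω * δ * Real.sinc (ω * δ) := by
    by_cases h0 : ω * δ = 0
    · simp [h0]
    · rw [Real.sinc_of_ne_zero h0, ← mul_div_assoc, mul_div_cancel_left₀ _ h0]
  calc Real.sin (ω * θ) * Real.cos (ω * δ) + Real.cos (ω * θ) * Real.sin (ω * δ) -
        (Real.sin (ω * θ) * Real.cos (ω * δ) - Real.cos (ω * θ) * Real.sin (ω * δ))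
      = 2 * Real.sin (ω * δ) * Real.cos (ω * θ) := by ring
    _ = 2 * δ * (ω * Real.sinc (ω * δ)) * Real.cos (ω * θ) := by rw [h]; ring

/-! ## §2 The Steklov transform of a finite trigonometric sum [folklore] -/

variable {σ : Type*}

/-- **THE STEKLOV TRANSFORM IS A BOX AVERAGE.**  For `T(θ) = Σ_{p∈P}(a_p cos(ω_pθ) + b_p sin(ω_pθ))` and `δ`:
`2δ·Σ_p sinc(ω_pδ)(a_p cos(ω_pθ) + b_p sin(ω_pθ)) = ∫_{θ−δ}^{θ+δ} T`. [folklore] -/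
theorem steklov_eq_integral (P : Finset σ) (a b ω : σ → ℝ) (δ θ : ℝ) :
    2 * δ * ∑ p ∈ P, Real.sinc (ω p * δ) * (a p * Real.cos (ω p * θ) + b p * Real.sin (ω p * θ)) =
      ∫ u in (θ - δ)..(θ + δ), ∑ p ∈ P, (a p * Real.cos (ω p * u) + b p * Real.sin (ω p * u)) := by
  rw [intervalIntegral.integral_finsetSum fun p _ =>
    (by fun_prop : Continuous fun u => a p * Real.cos (ω p * u) + b p * Real.sin (ω p * u)).intervalIntegrable _ _, Finset.mul_sum]
  refine Finset.sum_congr rfl fun p _ => ?_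
  rw [intervalIntegral.integral_add ((by fun_prop : Continuous fun u => a p * Real.cos (ω p * u)).intervalIntegrable _ _)
    ((by fun_prop : Continuous fun u => b p * Real.sin (ω p * u)).intervalIntegrable _ _),
    intervalIntegral.integral_const_mul, intervalIntegral.integral_const_mul, integral_cos_mul_window, integral_sin_mul_window]
  ring

/-- **THE DERIVATIVE OF THE STEKLOV TRANSFORM** (termwise). [bookkeeping] -/
theorem hasDerivAt_steklov (P : Finset σ) (a b ω : σ → ℝ) (δ θ : ℝ) :
    HasDerivAt (fun θ => ∑ p ∈ P, Real.sinc (ω p * δ) * (a p * Real.cos (ω p * θ) + b p * Real.sin (ω p * θ)))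
      (∑ p ∈ P, ω p * Real.sinc (ω p * δ) * (b p * Real.cos (ω p * θ) - a p * Real.sin (ω p * θ))) θ := by
  refine HasDerivAt.fun_sum fun p _ => ?_
  have hc : HasDerivAt (fun θ => Real.cos (ω p * θ)) (-Real.sin (ω p * θ) * (ω p * 1)) θ :=
    ((hasDerivAt_id θ).const_mul (ω p)).cos
  have hs : HasDerivAt (fun θ => Real.sin (ω p * θ)) (Real.cos (ω p * θ) * (ω p * 1)) θ :=
    ((hasDerivAt_id θ).const_mul (ω p)).sin
  have h := ((hc.const_mul (a p)).add (hs.const_mul (b p))).const_mul (Real.sinc (ω p * δ))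
  exact h.congr_deriv (by ring)

/-- **THE DERIVATIVE IS A DIFFERENCE QUOTIENT**: `2δ·g′(θ) = T(θ + δ) − T(θ − δ)`. [folklore] -/
theorem steklovDeriv_eq_diffQuot (P : Finset σ) (a b ω : σ → ℝ) (δ θ : ℝ) :
    2 * δ * ∑ p ∈ P, ω p * Real.sinc (ω p * δ) * (b p * Real.cos (ω p * θ) - a p * Real.sin (ω p * θ)) =
      (∑ p ∈ P, (a p * Real.cos (ω p * (θ + δ)) + b p * Real.sin (ω p * (θ + δ)))) -
        ∑ p ∈ P, (a p * Real.cos (ω p * (θ - δ)) + b p * Real.sin (ω p * (θ - δ))) := by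
  rw [← Finset.sum_sub_distrib, Finset.mul_sum]
  refine Finset.sum_congr rfl fun p _ => ?_
  have hc := cos_window_diff (ω p) θ δ
  have hs := sin_window_diff (ω p) θ δ
  calc 2 * δ * (ω p * Real.sinc (ω p * δ) * (b p * Real.cos (ω p * θ) - a p * Real.sin (ω p * θ)))
      = a p * (-(2 * δ * (ω p * Real.sinc (ω p * δ)) * Real.sin (ω p * θ))) +
          b p * (2 * δ * (ω p * Real.sinc (ω p * δ)) * Real.cos (ω p * θ)) := by ring
    _ = a p * (Real.cos (ω p * (θ + δ)) - Real.cos (ω p * (θ - δ))) + b p * (Real.sin (ω p * (θ + δ)) - Real.sin (ω p * (θ - δ))) := by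
        rw [hc, hs]
    _ = _ := by ring

/-- **THE PRICES OF THE STEKLOV TRANSFORM FROM A LIPSCHITZ `T`.**  If `T(θ) = Σ_p(a_p cos(ω_pθ) + b_p sin(ω_pθ))` is `Λ`-Lipschitz on `ℝ` and
`δ > 0`, then with `g = Σ_p sinc(ω_pδ)(a_p cos + b_p sin)` and `g₁ = Σ_p ω_p sinc(ω_pδ)(b_p cos − a_p sin)`:
`|g₁| ≤ Λ`, `|g₁(u) − g₁(a)| ≤ (Λ∕δ)|u − a|`, `|g(u) − g(a) − g₁(a)(u − a)| ≤ (Λ∕δ)(u − a)²`, `|g(θ) − T(θ)| ≤ Λδ`. [folklore] -/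
theorem steklov_prices (P : Finset σ) (a b ω : σ → ℝ) {Λ δ : ℝ} (hδ : 0 < δ)
    (hΛ : ∀ u v, |(∑ p ∈ P, (a p * Real.cos (ω p * u) + b p * Real.sin (ω p * u))) -
        ∑ p ∈ P, (a p * Real.cos (ω p * v) + b p * Real.sin (ω p * v))| ≤ Λ * |u - v|) :
    (∀ θ, |∑ p ∈ P, ω p * Real.sinc (ω p * δ) * (b p * Real.cos (ω p * θ) - a p * Real.sin (ω p * θ))| ≤ Λ) ∧
    (∀ u v, |(∑ p ∈ P, ω p * Real.sinc (ω p * δ) * (b p * Real.cos (ω p * u) - a p * Real.sin (ω p * u))) -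
        ∑ p ∈ P, ω p * Real.sinc (ω p * δ) * (b p * Real.cos (ω p * v) - a p * Real.sin (ω p * v))| ≤ Λ / δ * |u - v|) ∧
    (∀ u v, |(∑ p ∈ P, Real.sinc (ω p * δ) * (a p * Real.cos (ω p * u) + b p * Real.sin (ω p * u))) -
        (∑ p ∈ P, Real.sinc (ω p * δ) * (a p * Real.cos (ω p * v) + b p * Real.sin (ω p * v))) -
        (∑ p ∈ P, ω p * Real.sinc (ω p * δ) * (b p * Real.cos (ω p * v) - a p * Real.sin (ω p * v))) * (u - v)| ≤
          Λ / δ * (u - v) ^ 2) ∧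
    (∀ θ, |(∑ p ∈ P, Real.sinc (ω p * δ) * (a p * Real.cos (ω p * θ) + b p * Real.sin (ω p * θ))) -
        ∑ p ∈ P, (a p * Real.cos (ω p * θ) + b p * Real.sin (ω p * θ))| ≤ Λ * δ) := by
  -- names for the three functions
  set T : ℝ → ℝ := fun θ => ∑ p ∈ P, (a p * Real.cos (ω p * θ) + b p * Real.sin (ω p * θ)) with hT
  set g : ℝ → ℝ := fun θ => ∑ p ∈ P, Real.sinc (ω p * δ) * (a p * Real.cos (ω p * θ) + b p * Real.sin (ω p * θ)) with hg
  set g₁ : ℝ → ℝ := fun θ => ∑ p ∈ P, ω p * Real.sinc (ω p * δ) * (b p * Real.cos (ω p * θ) - a p * Real.sin (ω p * θ))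
    with hg₁
  have hΛ' : ∀ u v, |T u - T v| ≤ Λ * |u - v| := hΛ
  have hΛ0 : 0 ≤ Λ := by
    have h1 : 0 ≤ Λ * |(1 : ℝ) - 0| := (abs_nonneg _).trans (hΛ' 1 0)
    simpa using h1
  have h2δ : (0 : ℝ) < 2 * δ := by linarith
  -- the difference-quotient identity
  have hdq : ∀ θ, g₁ θ = (T (θ + δ) - T (θ - δ)) / (2 * δ) := by
    intro θ
    rw [eq_div_iff h2δ.ne', mul_comm]
    exact steklovDeriv_eq_diffQuot P a b ω δ θ
  -- (i) `|g₁| ≤ Λ`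
  have h1 : ∀ θ, |g₁ θ| ≤ Λ := by
    intro θ
    rw [hdq, abs_div, abs_of_pos h2δ, div_le_iff₀ h2δ]
    calc |T (θ + δ) - T (θ - δ)| ≤ Λ * |(θ + δ) - (θ - δ)| := hΛ' _ _
      _ = Λ * (2 * δ) := by rw [show θ + δ - (θ - δ) = 2 * δ by ring, abs_of_pos h2δ]
  -- (ii) `g₁` is `(Λ/δ)`-Lipschitz
  have h2 : ∀ u v, |g₁ u - g₁ v| ≤ Λ / δ * |u - v| := by
    intro u v
    rw [hdq, hdq, ← sub_div, abs_div, abs_of_pos h2δ, div_le_iff₀ h2δ]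
    have e : T (u + δ) - T (u - δ) - (T (v + δ) - T (v - δ)) = (T (u + δ) - T (v + δ)) - (T (u - δ) - T (v - δ)) := by ring
    rw [e]
    calc |(T (u + δ) - T (v + δ)) - (T (u - δ) - T (v - δ))| ≤ |T (u + δ) - T (v + δ)| + |T (u - δ) - T (v - δ)| := abs_sub _ _
      _ ≤ Λ * |(u + δ) - (v + δ)| + Λ * |(u - δ) - (v - δ)| := add_le_add (hΛ' _ _) (hΛ' _ _)
      _ = Λ / δ * |u - v| * (2 * δ) := by
          rw [show u + δ - (v + δ) = u - v by ring, show u - δ - (v - δ) = u - v by ring]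
          field_simp; ring
  -- (iii) the `C^{1,1}` bound by the mean value inequality for `φ(w) = g(w) − g₁(v)·w`
  have h3 : ∀ u v, |g u - g v - g₁ v * (u - v)| ≤ Λ / δ * (u - v) ^ 2 := by
    intro u v
    have hderiv : ∀ w, HasDerivAt (fun w => g w - g₁ v * w) (g₁ w - g₁ v) w := by
      intro w
      have hg' : HasDerivAt g (g₁ w) w := hasDerivAt_steklov P a b ω δ w
      have hl : HasDerivAt (fun w => g₁ v * w) (g₁ v * 1) w := (hasDerivAt_id w).const_mul (g₁ v)
      rw [mul_one] at hl
      exact hg'.sub hl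
    have hbound : ∀ w ∈ Set.uIcc v u, ‖g₁ w - g₁ v‖ ≤ Λ / δ * |u - v| := by
      intro w hw
      rw [Real.norm_eq_abs]
      exact (h2 w v).trans (mul_le_mul_of_nonneg_left (Set.abs_sub_left_of_mem_uIcc hw) (div_nonneg hΛ0 hδ.le))
    have hmv := Convex.norm_image_sub_le_of_norm_hasDerivWithin_le (fun w _ => (hderiv w).hasDerivWithinAt) hbound
      (convex_uIcc v u) Set.left_mem_uIcc Set.right_mem_uIcc
    rw [Real.norm_eq_abs, Real.norm_eq_abs] at hmv
    have e : g u - g₁ v * u - (g v - g₁ v * v) = g u - g v - g₁ v * (u - v) := by ring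
    rw [e] at hmv
    calc |g u - g v - g₁ v * (u - v)| ≤ Λ / δ * |u - v| * |u - v| := hmv
      _ = Λ / δ * (u - v) ^ 2 := by rw [mul_assoc, ← sq, sq_abs]
  -- (iv) `|g − T| ≤ Λδ` by the box-average representation
  have h4 : ∀ θ, |g θ - T θ| ≤ Λ * δ := by
    intro θ
    have hrep : g θ = (∫ u in (θ - δ)..(θ + δ), T u) / (2 * δ) := by
      rw [eq_div_iff h2δ.ne', mul_comm]
      exact steklov_eq_integral P a b ω δ θ
    have hTc : Continuous T := by rw [hT]; fun_prop
    have hconst : T θ = (∫ _u in (θ - δ)..(θ + δ), T θ) / (2 * δ) := by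
      rw [intervalIntegral.integral_const, smul_eq_mul, show θ + δ - (θ - δ) = 2 * δ by ring]; field_simp
    rw [hrep, hconst, ← sub_div, ← intervalIntegral.integral_sub (hTc.intervalIntegrable _ _) (by simp), abs_div,
      abs_of_pos h2δ, div_le_iff₀ h2δ]
    calc |∫ u in (θ - δ)..(θ + δ), (T u - T θ)| ≤ (Λ * δ) * |θ + δ - (θ - δ)| := by
          rw [← Real.norm_eq_abs]
          refine intervalIntegral.norm_integral_le_of_norm_le_const fun u hu => ?_
          rw [Real.norm_eq_abs]
          refine (hΛ' u θ).trans (mul_le_mul_of_nonneg_left ?_ hΛ0)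
          rw [Set.uIoc_of_le (by linarith)] at hu
          exact abs_le.2 ⟨by linarith [hu.1], by linarith [hu.2]⟩
      _ = Λ * δ * (2 * δ) := by rw [show θ + δ - (θ - δ) = 2 * δ by ring, abs_of_pos h2δ]
  exact ⟨h1, h2, h3, h4⟩

/-! ## §3 ★★ The Fejér–Steklov smoothing of a periodic Lipschitz function [folklore] -/

/-- ★★ **FEJÉR–STEKLOV SMOOTHING.**  Let `f : ℝ → ℝ` be continuous, `2π`-periodic, `Λ`-Lipschitz (`|f(a) − f(b)| ≤ Λ|a − b|`) with `|f| ≤ M`, and let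
`L ≥ 1`, `δ > 0`.  Then there are coefficients `α, β` and frequencies `ω` indexed by `p ∈ range L × range L` (`ω_p = |p₁ − p₂| ∈ [0, L]`,
`Σ_p(|α_p| + |β_p|) ≤ 2LM`) such that the trigonometric link `g(θ) = Σ_p(α_p cos(ω_pθ) + β_p sin(ω_pθ))` and its derivative
`g₁(θ) = Σ_p ω_p(β_p cos(ω_pθ) − α_p sin(ω_pθ))` satisfy `|g(u) − g(a) − g₁(a)(u − a)| ≤ (Λ∕δ)(u − a)²`, `|g₁| ≤ Λ` and
`|g(θ) − f(θ)| ≤ Λ(δ + π(1 + log L)∕L)` for all reals (`g` = the Steklov box average of width `2δ` of the Fejér mean of order `L` of `f`).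
READING: with `δ = 1∕L` a trigonometric polynomial of degree `< L` within `Λ(1 + π + π log L)∕L` of `f` whose `C^{1,1}` constant is `ΛL` — the input of
module 151's smoothed-link first-order law, priced by `Λ` alone. [folklore] -/
theorem exists_trigLink_near_periodicLipschitz {f : ℝ → ℝ} {Λ M : ℝ} (hfc : Continuous f) (hper : Function.Periodic f (2 * π))
    (hΛ : ∀ a b, |f a - f b| ≤ Λ * |a - b|) (hM : ∀ w, |f w| ≤ M) {L : ℕ} (hL : 1 ≤ L) {δ : ℝ} (hδ : 0 < δ) :
    ∃ α β ω : ℕ × ℕ → ℝ, (∀ p, 0 ≤ ω p) ∧ (∀ p ∈ range L ×ˢ range L, ω p ≤ L) ∧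
      (∑ p ∈ range L ×ˢ range L, (|α p| + |β p|) ≤ 2 * L * M) ∧
      (∀ u a, |(∑ p ∈ range L ×ˢ range L, (α p * Real.cos (ω p * u) + β p * Real.sin (ω p * u))) -
          (∑ p ∈ range L ×ˢ range L, (α p * Real.cos (ω p * a) + β p * Real.sin (ω p * a))) -
          (∑ p ∈ range L ×ˢ range L, ω p * (β p * Real.cos (ω p * a) - α p * Real.sin (ω p * a))) * (u - a)| ≤
        Λ / δ * (u - a) ^ 2) ∧
      (∀ a, |∑ p ∈ range L ×ˢ range L, ω p * (β p * Real.cos (ω p * a) - α p * Real.sin (ω p * a))| ≤ Λ) ∧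
      (∀ θ, |(∑ p ∈ range L ×ˢ range L, (α p * Real.cos (ω p * θ) + β p * Real.sin (ω p * θ))) - f θ| ≤
        Λ * (δ + π * (1 + Real.log L) / L)) := by
  have hπ := Real.pi_pos
  have hLr : (0 : ℝ) < L := by exact_mod_cast hL
  have hM0 : 0 ≤ M := (abs_nonneg _).trans (hM 0)
  have hΛ0 : 0 ≤ Λ := by
    have h1 : 0 ≤ Λ * |(1 : ℝ) - 0| := (abs_nonneg _).trans (hΛ 1 0)
    simpa using h1
  -- the Fejér data
  set ω : ℕ × ℕ → ℝ := fun p => ((((p.1 : ℤ) - p.2).natAbs : ℕ) : ℝ) with hω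
  set a : ℕ × ℕ → ℝ := fun p => (1 / (2 * π * L)) * ∫ w in (-π)..π, f w * Real.cos (ω p * w) with ha
  set b : ℕ × ℕ → ℝ := fun p => (1 / (2 * π * L)) * ∫ w in (-π)..π, f w * Real.sin (ω p * w) with hb
  set P : Finset (ℕ × ℕ) := range L ×ˢ range L with hP
  -- the Fejér mean as a sum over `P`
  have hT : ∀ θ, (1 / (2 * π)) * ∫ v in (-π)..π, f (θ - v) * fejerKernel L v =
      ∑ p ∈ P, (a p * Real.cos (ω p * θ) + b p * Real.sin (ω p * θ)) := by
    intro θ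
    rw [fejerMean_eq_trigSum hfc hper L θ, hP, Finset.sum_product]
    refine Finset.sum_congr rfl fun n _ => Finset.sum_congr rfl fun m _ => ?_
    rw [ha, hb, hω]
    ring
  -- `T` is `Λ`-Lipschitz
  have hTLip : ∀ u v, |(∑ p ∈ P, (a p * Real.cos (ω p * u) + b p * Real.sin (ω p * u))) -
      ∑ p ∈ P, (a p * Real.cos (ω p * v) + b p * Real.sin (ω p * v))| ≤ Λ * |u - v| := by
    intro u v
    rw [← hT u, ← hT v]
    exact abs_fejerMean_sub_fejerMean_le hfc hΛ hL u v
  obtain ⟨h1, -, h3, h4⟩ := steklov_prices P a b ω hδ hTLip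
  -- the two sums in the announced shape
  have hsum_g : ∀ θ, (∑ p ∈ P, (Real.sinc (ω p * δ) * a p * Real.cos (ω p * θ) + Real.sinc (ω p * δ) * b p * Real.sin (ω p * θ))) =
      ∑ p ∈ P, Real.sinc (ω p * δ) * (a p * Real.cos (ω p * θ) + b p * Real.sin (ω p * θ)) :=
    fun θ => Finset.sum_congr rfl fun p _ => by ring
  have hsum_g₁ : ∀ θ, (∑ p ∈ P, ω p * (Real.sinc (ω p * δ) * b p * Real.cos (ω p * θ) - Real.sinc (ω p * δ) * a p * Real.sin (ω p * θ))) =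
      ∑ p ∈ P, ω p * Real.sinc (ω p * δ) * (b p * Real.cos (ω p * θ) - a p * Real.sin (ω p * θ)) :=
    fun θ => Finset.sum_congr rfl fun p _ => by ring
  refine ⟨fun p => Real.sinc (ω p * δ) * a p, fun p => Real.sinc (ω p * δ) * b p, ω, fun p => Nat.cast_nonneg _, ?_, ?_, ?_, ?_, ?_⟩
  · -- frequencies `≤ L`
    intro p hp
    rw [hP, Finset.mem_product, Finset.mem_range, Finset.mem_range] at hp
    have : ((p.1 : ℤ) - p.2).natAbs ≤ L := by omega
    show ((((p.1 : ℤ) - p.2).natAbs : ℕ) : ℝ) ≤ L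
    exact_mod_cast this
  · -- mass
    have hcoef : ∀ p ∈ P, |Real.sinc (ω p * δ) * a p| + |Real.sinc (ω p * δ) * b p| ≤ 2 * M / L := by
      intro p _
      obtain ⟨hc, hs⟩ := abs_fourierCoeff_le hM (ω p)
      have hsinc := Real.abs_sinc_le_one (ω p * δ)
      have hc' : |a p| ≤ M / L := by
        rw [ha, abs_mul, abs_of_pos (by positivity : (0 : ℝ) < 1 / (2 * π * L))]
        calc 1 / (2 * π * L) * |∫ w in (-π)..π, f w * Real.cos (ω p * w)| ≤ 1 / (2 * π * L) * (2 * π * M) :=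
              mul_le_mul_of_nonneg_left hc (by positivity)
          _ = M / L := by field_simp
      have hs' : |b p| ≤ M / L := by
        rw [hb, abs_mul, abs_of_pos (by positivity : (0 : ℝ) < 1 / (2 * π * L))]
        calc 1 / (2 * π * L) * |∫ w in (-π)..π, f w * Real.sin (ω p * w)| ≤ 1 / (2 * π * L) * (2 * π * M) :=
              mul_le_mul_of_nonneg_left hs (by positivity)
          _ = M / L := by field_simp
      rw [abs_mul (Real.sinc _) (a p), abs_mul (Real.sinc _) (b p)]
      have e : 2 * M / L = 1 * (M / L) + 1 * (M / L) := by ring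
      rw [e]
      exact add_le_add (mul_le_mul hsinc hc' (abs_nonneg _) zero_le_one) (mul_le_mul hsinc hs' (abs_nonneg _) zero_le_one)
    calc ∑ p ∈ P, (|Real.sinc (ω p * δ) * a p| + |Real.sinc (ω p * δ) * b p|) ≤ ∑ _p ∈ P, 2 * M / L := Finset.sum_le_sum hcoef
      _ = (L * L : ℝ) * (2 * M / L) := by
          rw [sum_const, hP, Finset.card_product, Finset.card_range, nsmul_eq_mul]; push_cast; ring
      _ = 2 * L * M := by field_simp
  · -- `C^{1,1}`
    intro u v
    rw [hsum_g u, hsum_g v, hsum_g₁ v]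
    exact h3 u v
  · -- `|g₁| ≤ Λ`
    intro θ
    rw [hsum_g₁ θ]
    exact h1 θ
  · -- `|g − f|`
    intro θ
    have hS := h4 θ
    have hF := abs_fejerMean_sub_le hfc hΛ hL θ
    rw [hT θ] at hF
    rw [hsum_g θ]
    calc |(∑ p ∈ P, Real.sinc (ω p * δ) * (a p * Real.cos (ω p * θ) + b p * Real.sin (ω p * θ))) - f θ|
        ≤ |(∑ p ∈ P, Real.sinc (ω p * δ) * (a p * Real.cos (ω p * θ) + b p * Real.sin (ω p * θ))) -
            ∑ p ∈ P, (a p * Real.cos (ω p * θ) + b p * Real.sin (ω p * θ))| +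
          |(∑ p ∈ P, (a p * Real.cos (ω p * θ) + b p * Real.sin (ω p * θ))) - f θ| := abs_sub_le _ _ _
      _ ≤ Λ * δ + Λ * (π * (1 + Real.log L) / L) := add_le_add hS hF
      _ = Λ * (δ + π * (1 + Real.log L) / L) := by ring

end Summit.QuantumFields.YangMills.Theorems.BalabanUVNodesN19FejerSteklovSmoothing

end
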